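import Literature.NumberTheory.LFunctions.DirichletLAtZero
import Literature.NumberTheory.EllipticCurves.KrizLi2019.EisensteinHeegnerLog
import Mathlib.FieldTheory.IsAlgClosed.Basic
import Mathlib.FieldTheory.IntermediateField.Adjoin.Basic
import HarnessLib

/-!
# `B_{1,χ} ≠ 0` for every ODD primitive Dirichlet character with values in ANY field of
# characteristic zero — in particular for the `ℚ_p`-valued characters of Kriz–Li 2019
# (`KrizLi2019.bernoulliOnePrim χ ≠ 0` for odd `χ`)

Topic `Literature/NumberTheory/LFunctions`. THEOREMS ONLY (no definition, no named fact, no `sorry`).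

The classical fact (Washington, *Introduction to Cyclotomic Fields*, Cor. 4.4 / Thm. 4.2; Montgomery–
Vaughan Cor. 10.8): for an odd PRIMITIVE Dirichlet character `χ` one has `B_{1,χ} = -L(0,χ) ≠ 0`
(functional equation + Dirichlet's `L(1,χ̄) ≠ 0`). The tree has it over `ℂ`
(`ExplicitPsiChar.LFunction_zero_ne_zero_of_odd`, `dirichletLFunction_apply_zero_of_odd` in
`DirichletLAtZero`). The consumers on the Birch–Swinnerton-Dyer side (Mazur–Wiles / Herbrand–Ribet
dictionaries: `ImaginaryAbelianFieldOddChiClassNumber`, the `PrintCFram` level dictionary) work with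
characters valued in `ℚ_p` and carry the hypothesis `bernoulliOnePrim χ⁻¹ ≠ 0` undischarged. This file
TRANSFERS the complex statement to characters with values in any field `L` of characteristic `0`:
the finitely many values of `χ` are roots of unity, hence generate an intermediate field
`K = ℚ(χ) ⊆ L` algebraic over `ℚ`, which embeds into `ℂ` (`IsAlgClosed.lift`); generalized Bernoulli
numbers commute with ring homomorphisms and the conductor (so primitivity) and parity of a character
are unchanged under an injective change of coefficients.

## Main statements (the bookkeeping of §1/§3 — functoriality `B_{k, g ∘ χ} = g (B_{k,χ})`,
## invariance of conductor / primitivity / parity under an injective change of coefficients, the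
## factorisation through `ℚ(χ)` — is kept PRIVATE: uncited plumbing)

* `generalizedBernoulli_one_eq_sum_mul_val_div` — `B_{1,χ} = (1/N) ∑ χ(j) j` for `χ ≠ 1` (any field of
  characteristic `0`).
* `generalizedBernoulli_one_ne_zero_of_isPrimitive_of_odd_complex` — `B_{1,χ} ≠ 0`, `χ` odd primitive
  complex-valued (the tree's `L(0,χ) ≠ 0` read through `generalizedBernoulli`).
* `generalizedBernoulli_one_ne_zero_of_isPrimitive_of_odd` — the same for values in any field of
  characteristic `0`.
* `bernoulliOnePrim_ne_zero_of_odd`, `bernoulliOnePrim_inv_ne_zero_of_odd` — `KrizLi2019.bernoulliOnePrim χ ≠ 0`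
  (resp. `… χ⁻¹ ≠ 0`) for every odd `ℚ_p`-valued Dirichlet character `χ` of any level.

Not here: the value `‖B_{1,χ}‖_p` (Mazur–Wiles), even characters (`B_{1,χ} = 0` unless `χ = 1`).
-/

open DirichletCharacter Finset

namespace Literature.NumberTheory.LFunctions

/-! ### §1 Change of coefficients for Dirichlet characters and generalized Bernoulli numbers -/

section RingHomComp

variable {R R' : Type*} [CommRing R] [CommRing R'] {n : ℕ}

/-- **Functoriality of generalized Bernoulli numbers**: for a ring homomorphism `g : R → R'` of
`ℚ`-algebras and a Dirichlet character `χ` with values in `R`, `B_{k, g ∘ χ} = g(B_{k,χ})`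
(`B_{k,χ} = ∑_j χ(j) · c_j` with rational `c_j`, and `g` fixes `ℚ`). [folklore] -/
private theorem generalizedBernoulli_ringHomComp [Algebra ℚ R] [Algebra ℚ R'] [NeZero n] (k : ℕ)
    (χ : DirichletCharacter R n) (g : R →+* R') :
    generalizedBernoulli k (χ.ringHomComp g) = g (generalizedBernoulli k χ) := by
  rw [generalizedBernoulli_eq_sum, generalizedBernoulli_eq_sum, map_sum]
  refine Finset.sum_congr rfl fun j _ ↦ ?_
  rw [map_mul, MulChar.ringHomComp_apply]
  congr 1
  have hg : g.comp (algebraMap ℚ R) = algebraMap ℚ R' := Subsingleton.elim _ _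
  exact (RingHom.congr_fun hg _).symm

/-- The unit-group kernel of a Dirichlet character is unchanged by post-composition with an
injective ring homomorphism. [folklore] -/
private theorem ker_toUnitHom_ringHomComp (χ : DirichletCharacter R n) {g : R →+* R'}
    (hg : Function.Injective g) : (χ.ringHomComp g).toUnitHom.ker = χ.toUnitHom.ker := by
  ext x
  simp only [MonoidHom.mem_ker, Units.ext_iff, MulChar.coe_toUnitHom, MulChar.ringHomComp_apply,
    Units.val_one]
  exact ⟨fun h ↦ hg (by rwa [map_one]), fun h ↦ by rw [h, map_one]⟩

/-- A Dirichlet character factors through level `d` iff its composite with an injective ring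
homomorphism does. [folklore] -/
private theorem factorsThrough_ringHomComp_iff [NeZero n] (χ : DirichletCharacter R n) {g : R →+* R'}
    (hg : Function.Injective g) {d : ℕ} (hd : d ∣ n) :
    FactorsThrough (χ.ringHomComp g) d ↔ FactorsThrough χ d := by
  rw [factorsThrough_iff_ker_unitsMap hd, factorsThrough_iff_ker_unitsMap hd,
    ker_toUnitHom_ringHomComp χ hg]

/-- The set of levels through which a Dirichlet character factors is unchanged by post-composition
with an injective ring homomorphism. [folklore] -/
private theorem conductorSet_ringHomComp [NeZero n] (χ : DirichletCharacter R n) {g : R →+* R'}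
    (hg : Function.Injective g) : conductorSet (χ.ringHomComp g) = conductorSet χ := by
  ext d
  simp only [mem_conductorSet_iff]
  by_cases hd : d ∣ n
  · exact factorsThrough_ringHomComp_iff χ hg hd
  · exact ⟨fun h ↦ absurd h.dvd hd, fun h ↦ absurd h.dvd hd⟩

/-- **The conductor of a Dirichlet character is unchanged by an injective change of
coefficients.** [folklore] -/
private theorem conductor_ringHomComp [NeZero n] (χ : DirichletCharacter R n) {g : R →+* R'}
    (hg : Function.Injective g) :
    DirichletCharacter.conductor (χ.ringHomComp g) = DirichletCharacter.conductor χ := by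
  rw [DirichletCharacter.conductor, DirichletCharacter.conductor, conductorSet_ringHomComp χ hg]

/-- **Primitivity of a Dirichlet character is unchanged by an injective change of coefficients.**
[folklore] -/
private theorem isPrimitive_ringHomComp_iff [NeZero n] (χ : DirichletCharacter R n) {g : R →+* R'}
    (hg : Function.Injective g) : IsPrimitive (χ.ringHomComp g) ↔ IsPrimitive χ := by
  rw [isPrimitive_def, isPrimitive_def, conductor_ringHomComp χ hg]

/-- Parity is unchanged by an injective change of coefficients: `g ∘ χ` is odd iff `χ` is.
[folklore] -/
private theorem odd_ringHomComp_iff (χ : DirichletCharacter R n) {g : R →+* R'}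
    (hg : Function.Injective g) :
    DirichletCharacter.Odd (χ.ringHomComp g) ↔ DirichletCharacter.Odd χ := by
  simp only [DirichletCharacter.Odd, MulChar.ringHomComp_apply]
  constructor
  · intro h
    apply hg
    rw [h, map_neg, map_one]
  · intro h
    rw [h, map_neg, map_one]

/-- The primitive character of an odd Dirichlet character is odd (any coefficient ring).
[folklore] -/
private theorem odd_primitiveCharacter_of_odd {S : Type*} [CommRing S] {m : ℕ} [NeZero m]
    {χ : DirichletCharacter S m} (hχ : χ.Odd) : χ.primitiveCharacter.Odd := by
  have h := changeLevel_eq_cast_of_dvd' χ.primitiveCharacter (conductor_dvd_level χ) (a := -1)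
    isCoprime_one_left.neg_left
  rw [changeLevel_primitiveCharacter] at h
  push_cast at h
  rw [DirichletCharacter.Odd, ← h]
  exact hχ

end RingHomComp

/-! ### §2 The complex statement in `generalizedBernoulli` currency -/

section Complex

variable {N : ℕ} [NeZero N]

/-- **`B_{1,χ} = (1/N) ∑_{j mod N} χ(j) · j`** for a NON-TRIVIAL Dirichlet character modulo `N` with
values in a field of characteristic `0` (Diamond–Shurman (4.30) at `k = 1`: `B₁(x) = x − ½` and
`∑_j χ(j) = 0`; the printed definition (1) of Kriz–Li 2019 §1.5, as in the tree's `ℚ_p`-valued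
`KrizLi2019.generalizedBernoulli_one_eq_sum_div`). [cite: KrizLi2019, §1.5 display (1) (p. 7)] -/
theorem generalizedBernoulli_one_eq_sum_mul_val_div {L : Type*} [Field L] [CharZero L]
    (χ : DirichletCharacter L N) (hχ : χ ≠ 1) :
    generalizedBernoulli 1 χ = (∑ j : ZMod N, χ j * (j.val : L)) / N := by
  have h0 : ∑ j : ZMod N, χ j = 0 := MulChar.sum_eq_zero_of_ne_one hχ
  have hc : ∀ c : ℕ, algebraMap ℚ L (genBernoulliCoeff 1 N c) = (c : L) / N - 2⁻¹ := by
    intro c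
    rw [genBernoulliCoeff_of_one_le le_rfl]
    simp [Polynomial.bernoulli_one]
  rw [generalizedBernoulli_eq_sum]
  simp_rw [hc, mul_sub, Finset.sum_sub_distrib, ← Finset.sum_mul, h0, zero_mul, sub_zero,
    Finset.sum_div]
  exact Finset.sum_congr rfl fun j _ ↦ by ring

/-- **`B_{1,χ} ≠ 0` for an odd PRIMITIVE complex Dirichlet character** (Washington Cor. 4.4;
Montgomery–Vaughan Cor. 10.8): `B_{1,χ} = -L(0,χ)` (`dirichletLFunction_apply_zero_of_odd`) and
`L(0,χ) ≠ 0` (`ExplicitPsiChar.LFunction_zero_ne_zero_of_odd`), read for the tree's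
`generalizedBernoulli 1`. [cite: Washington1997, Cor. 4.4] -/
theorem generalizedBernoulli_one_ne_zero_of_isPrimitive_of_odd_complex
    (χ : DirichletCharacter ℂ N) (hprim : χ.IsPrimitive) (hodd : χ.Odd) :
    generalizedBernoulli 1 χ ≠ 0 := by
  have hne : χ ≠ 1 := by
    rintro rfl
    have h1 : (1 : DirichletCharacter ℂ N) (-1) = -1 := hodd
    rw [MulChar.one_apply isUnit_one.neg] at h1
    norm_num at h1
  have hL := ExplicitPsiChar.LFunction_zero_ne_zero_of_odd hprim hne hodd
  rw [LValueZero.dirichletLFunction_apply_zero_of_odd hodd] at hL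
  rw [generalizedBernoulli_one_eq_sum_mul_val_div χ hne]
  intro h0
  apply hL
  rw [div_eq_zero_iff] at h0
  rcases h0 with h0 | h0
  · rw [show (∑ a : ZMod N, (a.val : ℂ) * χ a) = ∑ j : ZMod N, χ j * (j.val : ℂ) from
      Finset.sum_congr rfl fun j _ ↦ mul_comm _ _, h0, neg_zero, zero_div]
  · rw [h0, div_zero]

end Complex

/-! ### §3 Transfer to any field of characteristic zero -/

section Transfer

variable {L : Type*} [Field L] [CharZero L] {n : ℕ} [NeZero n]

/-- Every value of a Dirichlet character with values in a `ℚ`-algebra is INTEGRAL over `ℚ`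
(a root of unity or `0`). [folklore] -/
private theorem isIntegral_apply (χ : DirichletCharacter L n) (a : ZMod n) : IsIntegral ℚ (χ a) := by
  by_cases ha : IsUnit a
  · obtain ⟨u, rfl⟩ := ha
    have h1 : χ (u : ZMod n) ^ Nat.totient n = 1 := by
      rw [← map_pow, ← Units.val_pow_eq_pow_val, ZMod.pow_totient, Units.val_one, map_one]
    exact IsIntegral.of_pow (Nat.totient_pos.mpr (NeZero.pos n)) (by rw [h1]; exact isIntegral_one)
  · rw [χ.map_nonunit ha]
    exact isIntegral_zero

/-- **A Dirichlet character with values in a field `L` of characteristic `0` factors through an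
intermediate field `ℚ ⊆ K ⊆ L` ALGEBRAIC over `ℚ`** (namely `K = ℚ(values of χ)`, generated by
roots of unity). [folklore] -/
private theorem exists_intermediateField_ringHomComp_eq (χ : DirichletCharacter L n) :
    ∃ K : IntermediateField ℚ L, Algebra.IsAlgebraic ℚ K ∧
      ∃ χK : DirichletCharacter K n, χK.ringHomComp (algebraMap K L) = χ := by
  set S : Set L := Set.range fun a : ZMod n ↦ χ a with hS
  refine ⟨IntermediateField.adjoin ℚ S, IntermediateField.isAlgebraic_adjoin ?_, ?_⟩
  · rintro x ⟨a, rfl⟩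
    exact isIntegral_apply χ a
  · have hmem : ∀ a : ZMod n, χ a ∈ IntermediateField.adjoin ℚ S :=
      fun a ↦ IntermediateField.subset_adjoin ℚ S ⟨a, rfl⟩
    refine ⟨{ toFun := fun a ↦ ⟨χ a, hmem a⟩
              map_one' := Subtype.ext (by simp)
              map_mul' := fun a b ↦ Subtype.ext (by simp)
              map_nonunit' := fun a ha ↦ Subtype.ext (by simp [χ.map_nonunit ha]) }, ?_⟩
    exact MulChar.ext' fun a ↦ rfl

/-- **`B_{1,χ} ≠ 0` for an odd PRIMITIVE Dirichlet character with values in ANY field of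
characteristic zero** (e.g. `ℚ_p`, `ℚ̄_p`, a number field): transfer of the complex statement along
`L ⊇ K = ℚ(χ) ↪ ℂ`. [cite: Washington1997, Cor. 4.4] -/
theorem generalizedBernoulli_one_ne_zero_of_isPrimitive_of_odd (χ : DirichletCharacter L n)
    (hprim : χ.IsPrimitive) (hodd : χ.Odd) : generalizedBernoulli 1 χ ≠ 0 := by
  obtain ⟨K, hK, χK, hχK⟩ := exists_intermediateField_ringHomComp_eq χ
  haveI := hK
  have hι : Function.Injective (algebraMap K L) := (algebraMap K L).injective
  -- an embedding of the algebraic field `K` into `ℂ`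
  let σ : K →ₐ[ℚ] ℂ := IsAlgClosed.lift
  have hσ : Function.Injective σ.toRingHom := σ.toRingHom.injective
  have hprimK : χK.IsPrimitive := by
    rw [← isPrimitive_ringHomComp_iff χK hι, hχK]
    exact hprim
  have hoddK : χK.Odd := by
    rw [← odd_ringHomComp_iff χK hι, hχK]
    exact hodd
  have hC := generalizedBernoulli_one_ne_zero_of_isPrimitive_of_odd_complex
    (χK.ringHomComp σ.toRingHom) ((isPrimitive_ringHomComp_iff χK hσ).mpr hprimK)
    ((odd_ringHomComp_iff χK hσ).mpr hoddK)
  rw [generalizedBernoulli_ringHomComp] at hC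
  intro h0
  apply hC
  have hK0 : generalizedBernoulli 1 χK = 0 := by
    apply hι
    rw [← generalizedBernoulli_ringHomComp, hχK, h0, map_zero]
  rw [hK0, map_zero]

/-- `B_{1,χ⁻¹} ≠ 0` for an odd primitive character (the inverse is odd and primitive).
[cite: Washington1997, Cor. 4.4] -/
theorem generalizedBernoulli_one_inv_ne_zero_of_isPrimitive_of_odd (χ : DirichletCharacter L n)
    (hprim : χ.IsPrimitive) (hodd : χ.Odd) : generalizedBernoulli 1 χ⁻¹ ≠ 0 := by
  refine generalizedBernoulli_one_ne_zero_of_isPrimitive_of_odd χ⁻¹ ?_ ?_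
  · rw [isPrimitive_def, conductor_inv]
    exact hprim
  · rw [DirichletCharacter.Odd, MulChar.inv_apply_eq_inv', hodd, inv_neg, inv_one]

end Transfer

/-! ### §4 The `ℚ_p`-valued characters of Kriz–Li 2019: `bernoulliOnePrim χ ≠ 0` for odd `χ` -/

section Padic

open Literature.NumberTheory.EllipticCurves

variable {p : ℕ} [Fact p.Prime] {n : ℕ} [NeZero n]

/-- **`B_{1,χ̃} ≠ 0` for every ODD Dirichlet character `χ` with values in `ℚ_p`** (any level;
`χ̃` the primitive character inducing `χ`, as in Kriz–Li 2019 §2): the tree's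
`KrizLi2019.bernoulliOnePrim χ` is non-zero. Discharges the hypothesis `bernoulliOnePrim … ≠ 0` of the
Mazur–Wiles / Herbrand–Ribet consumers. [cite: Washington1997, Cor. 4.4] -/
theorem bernoulliOnePrim_ne_zero_of_odd (χ : DirichletCharacter ℚ_[p] n) (hχ : χ.Odd) :
    KrizLi2019.bernoulliOnePrim χ ≠ 0 := by
  rw [KrizLi2019.bernoulliOnePrim_def]
  haveI : NeZero χ.conductor := ⟨χ.conductor_ne_zero⟩
  exact generalizedBernoulli_one_ne_zero_of_isPrimitive_of_odd _ (primitiveCharacter_isPrimitive χ)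
    (odd_primitiveCharacter_of_odd hχ)

/-- **`B_{1,(χ⁻¹)~} ≠ 0` for every odd `ℚ_p`-valued Dirichlet character `χ`** — the form
`bernoulliOnePrim χ⁻¹ ≠ 0` in which the Birch–Swinnerton-Dyer consumers (`PrintCFram` level
dictionary, `ImaginaryAbelianFieldOddChiClassNumber`) carry the hypothesis.
[cite: Washington1997, Cor. 4.4] -/
theorem bernoulliOnePrim_inv_ne_zero_of_odd (χ : DirichletCharacter ℚ_[p] n) (hχ : χ.Odd) :
    KrizLi2019.bernoulliOnePrim χ⁻¹ ≠ 0 := by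
  refine bernoulliOnePrim_ne_zero_of_odd χ⁻¹ ?_
  rw [DirichletCharacter.Odd, MulChar.inv_apply_eq_inv', hχ, inv_neg, inv_one]

end Padic

end Literature.NumberTheory.LFunctions
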